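import Mathlib
import HarnessLib
import Summits.ResolutionOfSingularities.ResolutionOfSingularities.Theorems.WildQuotientsWildQuotientResolutionS1aExtendRees
import Summits.ResolutionOfSingularities.ResolutionOfSingularities.Theorems.WildQuotientsWildQuotientResolutionS1aKillClopen
import Summits.ResolutionOfSingularities.ResolutionOfSingularities.Theorems.WildQuotientsWildQuotientResolutionS1aReachAux

/-!
# S1a — GLUED KILLABILITY: the K stub from ONE local principal centre with closed support (no agreement, no canonicity)

[OURS · L1 W4.5c · lead-1 g11; FINDING F11 / proposal «GLUED KILLABILITY» for plan-1's SIG NP v1 (STATUS 2026-08-28)] — NOT statements of the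
manuscript; counted 0; AI-level work, weaker than expert review. Crux stmt-ResolutionOfSingularities-17941 `CyclicQuotientFourfolds`, line
`s1a-logminvertex` v11, K-side (`stub_killTouchReachAux`). Route-independent; SEMANTICS-AGNOSTIC (the bad set enters only through the (Z1)/G1
membership lemma `mem_support_of_mem_badLocus_of_mem_principalKillOpen`).

WHY. The cover theorems (p639895/p643066/p644505) glue SEVERAL kill charts along one component and need their trace filtrations to AGREE on overlaps;
K-U / K-LEAST / K-EXO discharge that only inside ONE node ring (charts of one move), while `KillableAt` offers unrelated node presentations at different
points (F11). If instead killability is recorded in GLUED form — «the point lies in a principal-centre chart of a LOCAL PRINCIPAL CENTRE (a principal centre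
for the restricted action on a `G`-stable open) whose support is closed in the model» — then the K conclusion is immediate from
`ExtendRees.exists_isPrincipalCentre_of_local` (p615490: extend by the unit filtration) and (Z1): no agreement, no K-U, no node refinement, no
ADD-BAD on the K side; all canonicity obligations sit where kills are BORN (the A-side producers, which work inside one move where a common node ring
exists — `CobordantKillCert.chart`, p641449).

* `GameFrame.GModel.GluedKillableAt M v` — research-free DEFINITION (OURS): `v` lies in a principal-centre chart of a local principal centre with closed
  support;
* `killableAt_of_gluedKillableAt` — glued ⇒ pointwise (`isPrincipalCentreChart_image`);
* ★★ `exists_isPrincipalCentre_touch_of_gluedKillableAt` — a BAD glued-killable point yields a principal centre of `M` whose support meets `Z(M)`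
  (= the conclusion of `KillTouchReachAux` at `M`);
* research def `KillGluedReachAux p` (OURS CANDIDATE, asserted nowhere): at every aux-reachable non-terminal model with `jInf = ⊥` SOME bad point is
  glued-killable; ★ `killTouchReachAux_of_killGluedReachAux : KillGluedReachAux p → KillTouchReachAux p`.
-/

set_option linter.dupNamespace false

noncomputable section

open CategoryTheory Limits AlgebraicGeometry TopologicalSpace Topology
open Literature.AlgebraicGeometry.Resolution Literature.AlgebraicGeometry.RelativeSpec
open Summit.ResolutionOfSingularities.ResolutionOfSingularities.Theorems.WildQuotientResolution.S1
open Summit.ResolutionOfSingularities.ResolutionOfSingularities.Theorems.WildQuotientResolution.S1.NodeAtlas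
open Summit.ResolutionOfSingularities.ResolutionOfSingularities.Theorems.WildQuotientResolution.S1.ExtendRees
open Summit.ResolutionOfSingularities.ResolutionOfSingularities.Theorems.WildQuotientResolution.S1.KillClopen

namespace Summit.ResolutionOfSingularities.ResolutionOfSingularities.Theorems.WildQuotientResolution.S1

namespace GameFrame.GModel

variable {p : ℕ} {X' X₁ : Scheme.{0}} {q : X' ⟶ X₁} {G : Type} [Group G] {ρ : G →* Aut X'} {g₀ : G}

/-- **Glued killability at `v`** (OURS; research-free definition): there is a `G`-stable open `U` of the model and a PRINCIPAL CENTRE `(𝒦, d)` for the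
restricted action on `U` whose degree-`d` support has CLOSED image in `M.V`, such that `v` lies in (the image of) one of its principal-centre charts.
[OURS · L1 W4.5c · F11 «GLUED KILLABILITY»] -/
def GluedKillableAt (M : GModel p q G ρ g₀) (v : M.V) : Prop :=
  ∃ (U : M.V.Opens) (hU : ∀ g : G, (M.act.aut g).hom ⁻¹ᵁ U = U) (𝒦 : ReesFiltration (U : Scheme.{0})) (d : ℕ),
    IsPrincipalCentre p (M.act.restrict U hU) g₀ 𝒦 d ∧
    IsClosed (U.ι.base '' (((𝒦.ideal d).support : Set (U : Scheme.{0})))) ∧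
    ∃ (O₀ : (M.act.restrict U hU).StableAffineOpens) (u : (U : Scheme.{0})),
      IsPrincipalCentreChart p (M.act.restrict U hU) g₀ 𝒦 d O₀ ∧ u ∈ O₀.1 ∧ U.ι.base u = v

/-- **Glued ⇒ pointwise**: a glued-killable point is killable (the image of the upstairs chart is a principal-centre chart of the extended filtration).
[OURS · L1 W4.5c] -/
theorem killableAt_of_gluedKillableAt (M : GModel p q G ρ g₀) {v : M.V} (h : M.GluedKillableAt v) : M.KillableAt v := by
  haveI : IsLocallyNoetherian M.V := M.isLocallyNoetherian
  obtain ⟨U, hU, 𝒦, d, hprin, -, O₀, u, hO₀, huO₀, rfl⟩ := h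
  have hcomm : ∀ g : G, ((M.act.restrict U hU).aut g).hom ≫ U.ι = U.ι ≫ (M.act.aut g).hom := fun g => by
    rw [ActionOver.restrict_aut_hom, ActionOver.restrictHom_ι]
  obtain ⟨O, hOeq, hO⟩ := isPrincipalCentreChart_image M.act (M.act.restrict U hU) U.ι rfl hcomm g₀ 𝒦 d O₀ hO₀
  refine ⟨pushforwardRees 𝒦 U.ι, d, O, hprin.1, ?_, hO⟩
  rw [hOeq]
  exact ⟨u, huO₀, rfl⟩

/-- ★★ **K FROM GLUED KILLABILITY**: at a model with Noetherian base, a BAD point that is glued-killable yields a PRINCIPAL CENTRE of the model whose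
support meets the bad locus — by `exists_isPrincipalCentre_of_local` (extension by the unit filtration, p615490) and (Z1)
(`mem_support_of_mem_badLocus_of_mem_principalKillOpen`, p620298). No agreement / canonicity / node refinement is used. [OURS · L1 W4.5c · F11] -/
theorem exists_isPrincipalCentre_touch_of_gluedKillableAt [Finite G] (hp : p.Prime) (hG : ∀ g : G, g ∈ Subgroup.zpowers g₀)
    (M : GModel p q G ρ g₀) (hB : M.HasNoetherianBase) {v : M.V} (hv : v ∈ M.badLocus) (h : M.GluedKillableAt v) :
    ∃ (𝒦' : ReesFiltration M.V) (d : ℕ), IsPrincipalCentre p M.act g₀ 𝒦' d ∧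
      (M.badLocus ∩ ((𝒦'.ideal d).support : Set M.V)).Nonempty := by
  obtain ⟨U, hU, 𝒦, d, hprin, hC, O₀, u, hO₀, huO₀, rfl⟩ := h
  obtain ⟨𝒦', hprin', -, hkill⟩ := exists_isPrincipalCentre_of_local M U hU 𝒦 hprin hC
  exact ⟨𝒦', d, hprin', U.ι.base u, hv,
    mem_support_of_mem_badLocus_of_mem_principalKillOpen hp hG M hB hprin' hv (hkill O₀ hO₀ u huO₀)⟩

/-- The support version: the principal centre produced from glued killability at `v` contains `v` in its support. [OURS · L1 W4.5c] -/
theorem exists_isPrincipalCentre_mem_support_of_gluedKillableAt [Finite G] (hp : p.Prime) (hG : ∀ g : G, g ∈ Subgroup.zpowers g₀)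
    (M : GModel p q G ρ g₀) (hB : M.HasNoetherianBase) {v : M.V} (hv : v ∈ M.badLocus) (h : M.GluedKillableAt v) :
    ∃ (𝒦' : ReesFiltration M.V) (d : ℕ), IsPrincipalCentre p M.act g₀ 𝒦' d ∧ v ∈ ((𝒦'.ideal d).support : Set M.V) := by
  obtain ⟨U, hU, 𝒦, d, hprin, hC, O₀, u, hO₀, huO₀, rfl⟩ := h
  obtain ⟨𝒦', hprin', -, hkill⟩ := exists_isPrincipalCentre_of_local M U hU 𝒦 hprin hC
  exact ⟨𝒦', d, hprin', mem_support_of_mem_badLocus_of_mem_principalKillOpen hp hG M hB hprin' hv (hkill O₀ hO₀ u huO₀)⟩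

end GameFrame.GModel

/-! ## The attack form `KillGluedReachAux p ⇒ KillTouchReachAux p` -/

/-- **`KillGluedReachAux p`** (OURS CANDIDATE research statement, asserted nowhere; binders VERBATIM those of `KillTouchReachAux`): at every non-terminal
model reachable by AUX moves from the initial model of a crux datum, with every bad point killable (`jInf = ⊥`), SOME bad point is GLUED-killable.
(Under the GLUED-KILLABILITY frame proposal this is the K stub itself, and it is what the A-side producers deliver over one move.) [OURS · L1 W4.5c · F11] -/
def KillGluedReachAux (p : ℕ) : Prop :=
  ∀ (k : Type) [Field k] [CharP k p] [PerfectField k] (X' X₁ : Scheme.{0})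
    (f : X₁ ⟶ Spec (.of k)) (q : X' ⟶ X₁) (G : Type) [Group G] [Finite G]
    (ρ : G →* Aut X'), Nat.card G = p → IsSeparated f → LocallyOfFiniteType f → QuasiCompact f →
    IsIntegral X₁ → ∀ [IsIntegral X'], Scheme.IsRegular X' → IsFinite q → Function.Surjective q.base →
    (∃ U : X₁.Opens, Dense (U : Set X₁) ∧ Etale (q ∣_ U)) →
    ∀ (hq : ∀ g : G, (ρ g).hom ≫ q = q),
    (∀ x y : X', q.base x = q.base y → ∃ g : G, (ρ g).hom.base x = y) →
    topologicalKrullDim X₁ ≤ 4 → Function.Injective ρ →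
    ∀ (g₀ : G), (∀ g : G, g ∈ Subgroup.zpowers g₀) → ∀ [IsLocallyNoetherian X']
      (h₀ : NodeAtlas p (⟨ρ, hq⟩ : ActionOver q G) g₀),
      ∀ M : GameFrame.GModel p q G ρ g₀, (GameFrame.GModel.initial hq h₀).ReachableAux M → ¬ M.Terminal → M.jInf = ⊥ →
        ∃ v ∈ M.badLocus, M.GluedKillableAt v

/-- ★ **`KillGluedReachAux p ⇒ KillTouchReachAux p`** (`p` prime). [OURS · L1 W4.5c · F11] -/
theorem killTouchReachAux_of_killGluedReachAux {p : ℕ} (hp : p.Prime) (h : KillGluedReachAux p) : KillTouchReachAux p := by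
  intro k _ _ _ X' X₁ f q G _ _ ρ hG hfs hflft hfqc hX₁ _ hreg hqfin hqsurj hU hq horb hdim hinj g₀ hg₀ _ h₀ M hM hT hj
  haveI := hflft
  haveI := hfqc
  haveI := hqfin
  obtain ⟨v, hv, hglued⟩ := h k X' X₁ f q G ρ hG hfs hflft hfqc hX₁ hreg hqfin hqsurj hU hq horb hdim hinj g₀ hg₀ h₀ M hM hT hj
  exact GameFrame.GModel.exists_isPrincipalCentre_touch_of_gluedKillableAt hp hg₀ M (GameFrame.GModel.hasNoetherianBase_of_datum f M) hv hglued

end Summit.ResolutionOfSingularities.ResolutionOfSingularities.Theorems.WildQuotientResolution.S1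

end
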